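import Literature.NumberTheory.EllipticCurves.ModularCurve
import HarnessLib

/-!
# Integrality of the Manin constant of the optimal curve (Edixhoven 1991, Prop. 2)

Topic `Literature/NumberTheory/EllipticCurves` (next to `ModularCurve.lean`, whose vocabulary —
`IsNewformOf`, `IsNeronLatticeOf`, `periodLattice`, Mathlib's `PeriodPair` — it is stated in).
ONE named fact, vendored by the librarian (sweep g23, 2026-08-16, promote events 3130399/3130558)
from a hypothesis binder that already occurs VERBATIM in two accepted theorems of the tree:
`hEd` of
`Literature.NumberTheory.Automorphic.exists_optimal_modularParametrizationData_of_edixhoven`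
(`Automorphic/ShimuraCurveRibetTakahashiOptimalProofs.lean`) and `hEd` of
`Summit.ABC.ABC.Theorems.exists_intCast_eq_multiplier_of_isSemistable_of_edixhoven`
(`Summits/ABC/ABC/Theorems/IsogenyGlueCongruenceDegreePrimesPolyBoundedStubMazurKenku.lean`), so
that those reductions (and the ≥ 6 `Summits/ABC` files threading the anonymous `hEd`) can name it.

* `edixhoven_optimalManinConstant_integral` — **Edixhoven 1991, Prop. 2** (= Agashe–Ribet–Stein
  2006, Thm. 2.2; lattice form, §5 p. 632): *the Manin constant of the optimal (strong Weil) curve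
  is an integer.* Written on lattices, as the consumers use it: let `W'/ℚ` be a globally minimal
  elliptic Weierstrass model with newform `f ∈ S₂(Γ₀(N))` (`IsNewformOf W' f`) and let `L'` be a
  Néron period pair of `W'/ℂ` (`IsNeronLatticeOf`); if a rational `q` rescales the period lattice
  `Λ_f = periodLattice f` of `f` EXACTLY onto the lattice of `L'` (`q Λ_f ⊆ L'` and every element
  of `L'` is `q w`, `w ∈ Λ_f`), then `q ∈ ℤ`. Indeed such a `W'` is a global minimal model of the
  strong Weil curve `E_f = ℂ/Λ_f` (`z ↦ q z` is an isomorphism `ℂ/Λ_f ≅ ℂ/L' = W'(ℂ)` over `ℚ`),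
  and the optimal parametrisation `𝔥 → X₀(N) → ℂ/Λ_f → W'(ℂ)` pulls the Néron differential back
  to `q · 2πi f(τ) dτ`, so `|q| = c_f`, the Manin constant of the optimal quotient, "a positive
  integer (cf. [Edixhoven])" (Pasten–Shimura quoting Edixhoven's Prop. 2: Néron mapping property on
  the smooth locus of `X₀(N)_ℤ` plus the `q`-expansion principle).

The statement is a theorem in print, NOT proved here (`def … : Prop`, D-0014); its discharge would
be `theorem edixhoven_optimalManinConstant_integral_holds`. Source reading: the consumers'
docstrings (provefact seats of `PastenShimura2024_cor_10_2` /
`exists_optimal_modularParametrizationData`, 2026-08-16) checked it against Pasten–Shimura §3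
p. 13 and Edixhoven Prop. 2.

## References

* B. Edixhoven, *On the Manin constants of modular elliptic curves*, in: Arithmetic Algebraic
  Geometry (Texel, 1989), Progr. Math. 89, Birkhäuser (1991), 25–39, Prop. 2. [EdixhovenManin1991]
* A. Agashe, K. Ribet, W. Stein, *The Manin constant*, Pure Appl. Math. Q. 2 (2006), Thm. 2.2.
  [AgasheRibetStein2006]
* H. Pasten, *Shimura curves and the abc conjecture* (with the 2024 published numbering), §3 p. 13.
  [PastenShimura2024]
-/

open scoped MatrixGroups ModularForm

open CongruenceSubgroup

namespace Literature.NumberTheory.EllipticCurves.ModularForms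

open _root_.WeierstrassCurve

/-- **Edixhoven 1991, Prop. 2 — the Manin constant of the optimal curve is an integer**
(= Agashe–Ribet–Stein 2006, Thm. 2.2), in the lattice form used by the tree: for a globally minimal
elliptic `W'/ℚ` with newform `f ∈ S₂(Γ₀(N))` and a Néron period pair `L'` of `W'/ℂ`, if a rational
`q` rescales `Λ_f = periodLattice f` exactly onto the lattice of `L'`, then `q ∈ ℤ` (such a `W'` is
the minimal model of the strong Weil curve `ℂ/Λ_f` and `|q|` is its Manin constant). VERBATIM the
hypothesis `hEd` of `exists_optimal_modularParametrizationData_of_edixhoven` and of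
`Summit.ABC.ABC.Theorems.exists_intCast_eq_multiplier_of_isSemistable_of_edixhoven`.
[cite: EdixhovenManin1991, Prop. 2] [cite: AgasheRibetStein2006, Thm. 2.2]
[cite: PastenShimura2024, §3 p. 13] -/
def edixhoven_optimalManinConstant_integral : Prop :=
  ∀ {N : ℕ} [NeZero N] {W' : WeierstrassCurve ℚ} [W'.IsElliptic] [W'.IsGloballyMinimal]
    {f : CuspForm (Gamma0 N) 2} {L' : PeriodPair}, IsNewformOf W' f →
    IsNeronLatticeOf (W'.baseChange ℂ) L' → ∀ q : ℚ,
    (∀ z ∈ periodLattice f, (q : ℂ) * z ∈ L'.lattice) →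
    (∀ z ∈ L'.lattice, ∃ w ∈ periodLattice f, z = q * w) → ∃ k : ℤ, (k : ℚ) = q

end Literature.NumberTheory.EllipticCurves.ModularForms
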